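import Literature.Probability.RandomPlanarGeometry.LoewnerDriverStability
import Literature.Probability.RandomPlanarGeometry.RestrictionDensityArc
import HarnessLib

/-!
# The Euler scheme for the chordal Loewner flow and the semigroup `𝒜₀` ([LSW] Lemma 3.5)

G. F. Lawler, O. Schramm, W. Werner, *Conformal restriction: the chordal case*, J. Amer. Math.
Soc. **16** (2003) 917–955, arXiv:math/0209343 (**[LSW]**), proof of Lemma 3.5, p. 13:
"`Φ_t := g_t - g_t(0)`, `Ũ_t := U_t - g_t(0)` … `∂_t Φ_t(z) = 2Φ_t(z)/((Φ_t(z) - Ũ_t)Ũ_t)`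
(3.4). Since `Ũ_t` is continuous and positive, there is a sequence of piecewise constant
functions `Ũ^{(n)}` such that `sup |Ũ^{(n)}_t - Ũ_t| → 0`. Let `Φ^{(n)}_t` be the solution of
(3.4) with `Ũ^{(n)}` replacing `Ũ`. Then, clearly, `Φ^{(n)}_s(z) → Φ_s(z)` … Note that the
solution of (3.4) with `Ũ_t` constant is of the form `G^λ_{t'}`, where `λ = Ũ_0` and `t'` is some
function of `t` and `Ũ_0`. It follows that `Φ^{(n)}_s` is in the semigroup generated by
`{G^λ_t : λ > 0, t ≥ 0}`."

This file carries out this step for the chordal Loewner chain `g_t = Loewner.map W t` of a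
continuous driving function `W` (`LoewnerChain`), in the UN-normalized frame, where a
piece on which the normalized driving function `Ũ` is frozen at the value `μ` is the chain of
the LINEAR driving function `u ↦ a - 2u/μ` (`a` the frozen value of `W`):

* `Literature.Probability.RandomPlanarGeometry.Loewner.linDriving a μ` — the frozen driving
  function `u ↦ a - 2u/μ = (a - μ) + μ W^{lsw}(u/μ²)` (`W^{lsw}_t = 1 - 2t`, `LoewnerSemigroup`);
  its Loewner map at time `Δ` is `w ↦ (a - μ - 2Δ/μ) + μ G_{Δ/μ²}((w - (a - μ))/μ)`
  (`map_linDriving`, scaling `IsSolution.scale` and translation `IsSolution.add_const`), i.e.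
  the restriction map `G^μ_{Δ/μ²} = Φ_{μ K_{Δ/μ²}}` of the GENERATOR `μ K_{Δ/μ²}` of `𝒜₀`
  conjugated by the real translations of the normalization, and its swallowing times are
  those of `W^{lsw}` rescaled (`swallowingTime_linDriving`);
* `Literature.Probability.RandomPlanarGeometry.Loewner.eulerStep`, `eulerTime`, `eulerOffset`,
  `eulerLevel`, `eulerDriving`, `eulerMap` — the **Euler scheme** with `N + 1` steps of size
  `Δ = S/(N+1)` for the chain of `W` on `[0, S]`: offsets `c₀ = 0`, `c_{i+1} = c_i - 2Δ/μ_i`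
  with levels `μ_i = W(t_i) - c_i` (`t_i = iΔ`), and maps `G^E_0 = id`,
  `G^E_{i+1} = g^{L_i}_Δ ∘ G^E_i` with `L_i = linDriving (W t_i) μ_i`;
* `Literature.Probability.RandomPlanarGeometry.AStage`, `Loewner.eulerStage` — the hulls
  `B_i ∈ 𝒜₀` (`IsLSWGenerated`, iterated `hullProduct`s of the generators `μ_j K_{Δ/μ_j²}`,
  `RestrictionSemigroup`) with their restriction maps `χ_i`, and the identities
  `G^E_i(z) = c_i + χ_i(z)` (`eulerMap_eq`), `ℍ ∖ B_i = {z ∈ ℍ : all steps alive}`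
  (`mem_diff_eulerStage`);
* `Literature.Probability.RandomPlanarGeometry.Loewner.dist_eulerMap_map_le` — **the error
  estimate**: if `0` flows beyond `S` with `Ũ_t = W_t - g_t(0) ≥ λ₋ > 0` on `[0, S]`, then for
  every `z` flowing beyond `S` and `δ`-away from `W` (`δ ≤ λ₋`), and `ω = osc(W, Δ) + 4Δ/λ₋`
  small (`ω ≤ δ/4`, `ω(e^{8S/δ²} - 1) < δ/4`): all Euler steps are alive at `z` and
  `|G^E_{N+1}(z) - g_S(z)| ≤ ω (e^{8S/δ²} - 1)` (induction over the steps with the two-driver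
  tube estimate `dist_map_le_of_driving_close` of `LoewnerDriverStability` and the cocycle
  `map_add`; the offsets are the Euler images of `0`, so the levels stay `≥ λ₋/2`).

The passage to the limit `N → ∞` (uniform continuity of `W`), the compactness argument giving
`δ`, and the assembly of the [LSW] convergence are in `RestrictionDensityLoewner`.

## References

* [LSW] proof of Lemma 3.5, arXiv p. 13 [LawlerSchrammWerner2003Restriction].
* G. F. Lawler, *Conformally Invariant Processes in the Plane*, AMS (2005), §4.1 (scaling,
  Rem. 4.9 cocycle) and §4.7 Prop. 4.47 [Lawler2005].
-/

noncomputable section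

open Set Filter Metric Complex
open UpperHalfPlane (upperHalfPlaneSet isOpen_upperHalfPlaneSet)
open scoped NNReal Topology Pointwise

namespace Literature.Probability.RandomPlanarGeometry

namespace Loewner

/-! ### The frozen (linear) driving functions and the generators of `𝒜₀` -/

section Lin

variable {a μ : ℝ}

/-- The positive level `μ` as a nonnegative real. [folklore] -/
def level (μ : ℝ) : ℝ≥0 := μ.toNNReal

/-- `(level μ : ℝ) = μ` for `μ ≥ 0`. [folklore] -/
@[simp] theorem coe_level (hμ : 0 ≤ μ) : (level μ : ℝ) = μ := Real.coe_toNNReal μ hμ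

/-- `level μ ≠ 0` for `μ > 0`. [folklore] -/
theorem level_ne_zero (hμ : 0 < μ) : level μ ≠ 0 := by
  rw [← NNReal.coe_ne_zero, coe_level hμ.le]; exact hμ.ne'

/-- **The frozen driving function** `L(u) = a - 2u/μ`, written as the translate by `a - μ` of
the rescaling `u ↦ μ W^{lsw}(u/μ²)` of `W^{lsw}_t = 1 - 2t` ([LSW] p. 13: "the solution of (3.4)
with `Ũ_t` constant is of the form `G^λ_{t'}`"; in the un-normalized frame a constant normalized
driver `Ũ ≡ μ` is the linear driver `a - 2u/μ`, the normalization moving by `-2/μ` per unit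
time). [cite: LawlerSchrammWerner2003Restriction, proof of Lemma 3.5 (p. 13)] -/
def linDriving (a μ : ℝ) : ℝ≥0 → ℝ :=
  fun u ↦ (level μ : ℝ) * lswDriving (u / level μ ^ 2) + (a - μ)

/-- `L(u) = a - 2u/μ` (`μ > 0`). [folklore] -/
theorem linDriving_apply (hμ : 0 < μ) (u : ℝ≥0) : linDriving a μ u = a - 2 * (u : ℝ) / μ := by
  simp only [linDriving, lswDriving_apply, NNReal.coe_div, NNReal.coe_pow, coe_level hμ.le]
  field_simp
  ring

/-- `L(0) = a`. [folklore] -/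
theorem linDriving_zero (hμ : 0 < μ) : linDriving a μ 0 = a := by
  rw [linDriving_apply hμ]; simp

/-- `L` is continuous. [folklore] -/
theorem continuous_linDriving (a μ : ℝ) : Continuous (linDriving a μ) :=
  ((continuous_const.mul (continuous_lswDriving.comp (continuous_id.div_const _))).add
    continuous_const)

/-- `|L(u) - a| = 2u/μ ≤ 2Δ/μ` for `u ≤ Δ`. [folklore] -/
theorem abs_linDriving_sub_le (hμ : 0 < μ) {u Δ : ℝ≥0} (hu : u ≤ Δ) :
    |linDriving a μ u - a| ≤ 2 * (Δ : ℝ) / μ := by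
  rw [linDriving_apply hμ, show a - 2 * (u : ℝ) / μ - a = -(2 * (u : ℝ) / μ) by ring, abs_neg,
    abs_of_nonneg (by positivity)]
  gcongr

/-- The point of `ℍ ∖ K` corresponding to `w` under the normalization of the frozen piece:
`v = (w - (a - μ))/μ`. [folklore] -/
theorem level_mul_add_eq (hμ : 0 < μ) (w : ℂ) :
    ((level μ : ℝ) : ℂ) * ((w - (a - μ : ℝ)) / μ) + (a - μ : ℝ) = w := by
  rw [coe_level hμ.le]
  have : (μ : ℂ) ≠ 0 := by exact_mod_cast hμ.ne'
  field_simp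
  ring

/-- **Swallowing times of the frozen chain** are those of `W^{lsw}` from `v = (w - (a - μ))/μ`,
rescaled by `μ²` (`swallowingTime_scale`, `swallowingTime_add_const`). [folklore] -/
theorem swallowingTime_linDriving (hμ : 0 < μ) (w : ℂ) :
    swallowingTime (linDriving a μ) w =
      ((level μ ^ 2 : ℝ≥0) : WithTop ℝ≥0) * swallowingTime lswDriving ((w - (a - μ : ℝ)) / μ) := by
  have h1 := swallowingTime_add_const (fun s ↦ (level μ : ℝ) * lswDriving (s / level μ ^ 2))
    (((level μ : ℝ) : ℂ) * ((w - (a - μ : ℝ)) / μ)) (a - μ)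
  rw [level_mul_add_eq hμ] at h1
  rw [show linDriving a μ = fun s ↦ (level μ : ℝ) * lswDriving (s / level μ ^ 2) + (a - μ) from rfl,
    h1, swallowingTime_scale (level_ne_zero hμ)]

/-- `Δ < T^L_w ↔ Δ/μ² < T^{lsw}_v`. [folklore] -/
theorem lt_swallowingTime_linDriving_iff (hμ : 0 < μ) (w : ℂ) (Δ : ℝ≥0) :
    (Δ : WithTop ℝ≥0) < swallowingTime (linDriving a μ) w ↔
      ((Δ / level μ ^ 2 : ℝ≥0) : WithTop ℝ≥0) < swallowingTime lswDriving ((w - (a - μ : ℝ)) / μ) := by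
  rw [swallowingTime_linDriving hμ, coe_div_lt_iff_lt_mul (pow_ne_zero 2 (level_ne_zero hμ))]

/-- **The Loewner map of the frozen chain is a conjugated generator of `𝒜₀`**: for `w` flowing
beyond `Δ`, `g^L_Δ(w) = (a - μ - 2Δ/μ) + μ G_{Δ/μ²}((w - (a - μ))/μ)`, `G_t = g^{lsw}_t + 2t` the
map of `K_t` (`lswMap`), i.e. `g^L_Δ = τ_{c'} ∘ Φ_{μK_{Δ/μ²}} ∘ τ_{-c}` with `c = a - μ`,
`c' = c - 2Δ/μ` ([LSW] p. 13, "`G^λ_{t'}` where `λ = Ũ_0` and `t'` is some function of `t` and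
`Ũ_0`": here `t' = Δ/μ²`). [cite: LawlerSchrammWerner2003Restriction, proof of Lemma 3.5 (p. 13)] -/
theorem map_linDriving (hμ : 0 < μ) {w : ℂ} {Δ : ℝ≥0}
    (hw : (Δ : WithTop ℝ≥0) < swallowingTime (linDriving a μ) w) :
    map (linDriving a μ) Δ w =
      ((a - μ - 2 * (Δ : ℝ) / μ : ℝ) : ℂ) +
        μ • lswMap (Δ / level μ ^ 2) (μ⁻¹ • (w - (a - μ : ℝ))) := by
  set v : ℂ := (w - (a - μ : ℝ)) / μ with hv
  have hμ' := level_ne_zero hμ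
  have hvT : ((Δ / level μ ^ 2 : ℝ≥0) : WithTop ℝ≥0) < swallowingTime lswDriving v :=
    (lt_swallowingTime_linDriving_iff hμ w Δ).1 hw
  have hv1 : v ≠ lswDriving 0 := ne_driving_of_lt_swallowingTime hvT
  obtain ⟨G, hG⟩ := exists_isSolution_swallowingTime_holds continuous_lswDriving hv1
  -- the rescaled and translated solution solves the frozen equation from `w`
  have hH := (hG.scale hμ').add_const (a - μ)
  rw [level_mul_add_eq hμ] at hH
  have hΔ : (Δ : WithTop ℝ≥0) < ((level μ ^ 2 : ℝ≥0) : WithTop ℝ≥0) * swallowingTime lswDriving v :=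
    (coe_div_lt_iff_lt_mul (pow_ne_zero 2 hμ') Δ _).1 hvT
  have h1 : map (linDriving a μ) Δ w = (level μ : ℂ) * G ((Δ : ℝ) / (level μ : ℝ) ^ 2) + (a - μ : ℝ) :=
    map_eq_of_isSolution (continuous_linDriving a μ) hH hΔ
  have h2 : map lswDriving (Δ / level μ ^ 2) v = G ((Δ / level μ ^ 2 : ℝ≥0) : ℝ) :=
    map_eq_of_isSolution continuous_lswDriving hG hvT
  have hsmul : μ⁻¹ • (w - (a - μ : ℝ)) = v := by
    rw [hv, Complex.real_smul, div_eq_inv_mul]; push_cast; ring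
  rw [h1, hsmul, Complex.real_smul, lswMap_apply, h2, NNReal.coe_div, NNReal.coe_pow, coe_level hμ.le]
  push_cast
  have : (μ : ℂ) ≠ 0 := by exact_mod_cast hμ.ne'
  field_simp
  ring

/-- The real point `a - μ` (the current image of `0`) flows for ever under the frozen chain
and moves to `a - μ - 2Δ/μ` at time `Δ`. [folklore] -/
theorem map_linDriving_base (hμ : 0 < μ) (Δ : ℝ≥0) :
    (Δ : WithTop ℝ≥0) < swallowingTime (linDriving a μ) ((a - μ : ℝ) : ℂ) ∧
      map (linDriving a μ) Δ ((a - μ : ℝ) : ℂ) = ((a - μ - 2 * (Δ : ℝ) / μ : ℝ) : ℂ) := by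
  have hT : (Δ : WithTop ℝ≥0) < swallowingTime (linDriving a μ) ((a - μ : ℝ) : ℂ) := by
    rw [lt_swallowingTime_linDriving_iff hμ, sub_self, zero_div, swallowingTime_lsw_zero]
    exact WithTop.coe_lt_top _
  refine ⟨hT, ?_⟩
  rw [map_linDriving hμ hT, sub_self, smul_zero, lswMap_zero, smul_zero, add_zero]

end Lin

end Loewner

/-! ### Stages of `𝒜₀`-hulls with their restriction maps -/

/-- A hull of `𝒜₀` together with a restriction map (the data carried along the Euler scheme:
`B ∈ 𝒜₀`, `B ∈ 𝒬*`, `χ = Φ_B`). [folklore] -/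
structure AStage where
  /-- the hull `B ∈ 𝒜₀` -/
  hull : Set ℂ
  /-- its restriction map `Φ_B` -/
  rmap : ConformalEquiv (upperHalfPlaneSet \ hull) upperHalfPlaneSet
  isStarHull : IsStarHull hull
  isRestrictionMap : IsRestrictionMap hull rmap
  isLSWGenerated : IsLSWGenerated hull

namespace AStage

/-- The empty stage `∅ ∈ 𝒜₀` with `Φ_∅ = id`. [folklore] -/
def empty : AStage :=
  ⟨∅, restrictionMapEmpty, isStarHull_empty, isRestrictionMap_empty, isLSWGenerated_empty⟩

/-- **Multiplication of a stage by a generator**: `B ↦ (μ K_τ) · B` (`hullProduct`), with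
restriction map `Φ_{μK_τ} ∘ Φ_B` (`hullProductMap`, `ConformalEquiv.smulHull`).
[cite: LawlerSchrammWerner2003Restriction, §2 p. 8 (Semigroups) and Prop. 3.3 proof (p. 11)] -/
def mul (s : AStage) (μ : ℝ) (hμ : 0 < μ) (τ : ℝ≥0) : AStage where
  hull := hullProduct (μ • lswHull τ) s.hull s.rmap
  rmap := hullProductMap ((lswMap τ).smulHull μ hμ) s.rmap
    ((isStarHull_lswHull τ).smul hμ).isBoundedHull.isClosed s.isStarHull.isBoundedHull.isClosed
  isStarHull := ((isStarHull_lswHull τ).smul hμ).hullProduct s.isStarHull s.isRestrictionMap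
  isRestrictionMap := ((isRestrictionMap_lswMap τ).smulHull hμ).hullProduct _ _ s.isRestrictionMap
  isLSWGenerated := (IsLSWGenerated.smul_lswHull hμ τ).of_isHullProduct s.isLSWGenerated
    (RestrictionConfig.isHullProduct_hullProduct ((isStarHull_lswHull τ).smul hμ) s.isStarHull
      s.isRestrictionMap)

/-- `Φ_{(μK_τ)·B}(z) = μ G_τ(Φ_B(z)/μ)`. [folklore] -/
theorem mul_rmap_apply (s : AStage) {μ : ℝ} (hμ : 0 < μ) (τ : ℝ≥0) (z : ℂ) :
    (s.mul μ hμ τ).rmap z = μ • lswMap τ (μ⁻¹ • s.rmap z) := rfl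

/-- **Membership in the product**: `z ∈ ℍ ∖ ((μK_τ)·B)` iff `z ∈ ℍ ∖ B` and `Φ_B(z)/μ` flows
beyond `τ` for `W^{lsw}`. [folklore] -/
theorem mem_diff_mul_iff (s : AStage) {μ : ℝ} (hμ : 0 < μ) (τ : ℝ≥0) {z : ℂ} :
    z ∈ upperHalfPlaneSet \ (s.mul μ hμ τ).hull ↔
      z ∈ upperHalfPlaneSet \ s.hull ∧
        (τ : WithTop ℝ≥0) < Loewner.swallowingTime lswDriving (μ⁻¹ • s.rmap z) := by
  have hHc : IsClosed (μ • lswHull τ) := ((isStarHull_lswHull τ).smul hμ).isBoundedHull.isClosed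
  have hBc : IsClosed s.hull := s.isStarHull.isBoundedHull.isClosed
  show z ∈ upperHalfPlaneSet \ hullProduct (μ • lswHull τ) s.hull s.rmap ↔ _
  rw [diff_hullProduct hHc hBc]
  simp only [mem_setOf_eq]
  refine and_congr_right fun hz ↦ ?_
  have hw : s.rmap z ∈ upperHalfPlaneSet := s.rmap.mapsTo hz
  have h1 : s.rmap z ∉ μ • lswHull τ ↔ μ⁻¹ • s.rmap z ∈ upperHalfPlaneSet \ lswHull τ := by
    rw [← mem_diff_smul_iff hμ]
    exact ⟨fun h ↦ ⟨hw, h⟩, fun h ↦ h.2⟩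
  have e := Set.ext_iff.1 (diff_lswHull τ) (μ⁻¹ • s.rmap z)
  rw [h1, e, Loewner.mem_domain_iff]
  have hwH : μ⁻¹ • s.rmap z ∈ upperHalfPlaneSet := by
    show 0 < (μ⁻¹ • s.rmap z).im
    rw [Complex.smul_im, smul_eq_mul]
    exact mul_pos (inv_pos.2 hμ) hw
  exact ⟨fun h ↦ h.2, fun h ↦ ⟨hwH, h⟩⟩

end AStage

/-! ### The Euler scheme -/

namespace Loewner

section Euler

variable (W : ℝ≥0 → ℝ) (S : ℝ≥0) (N : ℕ)

/-- The step `Δ = S/(N+1)`. [folklore] -/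
def eulerStep : ℝ≥0 := S / ((N : ℝ≥0) + 1)

/-- The times `t_i = iΔ`. [folklore] -/
def eulerTime (i : ℕ) : ℝ≥0 := (i : ℝ≥0) * eulerStep S N

/-- **The Euler offsets** `c₀ = 0`, `c_{i+1} = c_i - 2Δ/(W(t_i) - c_i)`: the images of `0` under
the scheme (`eulerMap_zero`), i.e. the approximations of `g_{t_i}(0)`. [folklore] -/
def eulerOffset : ℕ → ℝ
  | 0 => 0
  | i + 1 => eulerOffset i - 2 * (eulerStep S N : ℝ) / (W (eulerTime S N i) - eulerOffset i)

/-- **The Euler levels** `μ_i = W(t_i) - c_i`, the frozen values of the normalized driving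
function `Ũ = W - g(0)`. [folklore] -/
def eulerLevel (i : ℕ) : ℝ := W (eulerTime S N i) - eulerOffset W S N i

/-- The frozen driving function of step `i`: `L_i(u) = W(t_i) - 2u/μ_i`. [folklore] -/
def eulerDriving (i : ℕ) : ℝ≥0 → ℝ := linDriving (W (eulerTime S N i)) (eulerLevel W S N i)

/-- **The Euler maps** `G^E_0 = id`, `G^E_{i+1} = g^{L_i}_Δ ∘ G^E_i` (Loewner maps of the frozen
chains; [LSW] p. 13: "`Φ^{(n)}_t` the solution of (3.4) with `Ũ^{(n)}` replacing `Ũ`", here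
un-normalized). [cite: LawlerSchrammWerner2003Restriction, proof of Lemma 3.5 (p. 13)] -/
def eulerMap : ℕ → ℂ → ℂ
  | 0 => id
  | i + 1 => fun z ↦ map (eulerDriving W S N i) (eulerStep S N) (eulerMap i z)

open Classical in
/-- **The Euler hulls** `B_i ∈ 𝒜₀` with their restriction maps: `B₀ = ∅`,
`B_{i+1} = (μ_i K_{Δ/μ_i²}) · B_i` (while `μ_i > 0`; frozen otherwise, a case that does not occur
under the hypotheses of the error estimate). [cite: LawlerSchrammWerner2003Restriction, proof of Lemma 3.5 (p. 13)] -/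
def eulerStage : ℕ → AStage
  | 0 => AStage.empty
  | i + 1 =>
    if h : 0 < eulerLevel W S N i then
      (eulerStage i).mul (eulerLevel W S N i) h (eulerStep S N / level (eulerLevel W S N i) ^ 2)
    else eulerStage i

variable {W S N}

/-- `t_{i+1} = t_i + Δ`. [folklore] -/
theorem eulerTime_succ (i : ℕ) : eulerTime S N (i + 1) = eulerTime S N i + eulerStep S N := by
  simp [eulerTime, add_mul]

/-- `t_0 = 0`. [folklore] -/
@[simp] theorem eulerTime_zero : eulerTime S N 0 = 0 := by simp [eulerTime]

/-- `t_{N+1} = S`. [folklore] -/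
theorem eulerTime_last : eulerTime S N (N + 1) = S := by
  simp only [eulerTime, eulerStep, Nat.cast_add, Nat.cast_one]
  rw [mul_div_cancel₀ _ (by positivity)]

/-- `t_i ≤ S` for `i ≤ N + 1`. [folklore] -/
theorem eulerTime_le {i : ℕ} (hi : i ≤ N + 1) : eulerTime S N i ≤ S := by
  calc eulerTime S N i ≤ eulerTime S N (N + 1) := by
        simp only [eulerTime]; gcongr
    _ = S := eulerTime_last

/-- `Δ ≤ S`. [folklore] -/
theorem eulerStep_le : eulerStep S N ≤ S :=
  div_le_self bot_le (by simp)

/-- `W(t_i) - μ_i = c_i`. [folklore] -/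
theorem sub_eulerLevel (i : ℕ) : W (eulerTime S N i) - eulerLevel W S N i = eulerOffset W S N i := by
  simp [eulerLevel]

/-- `c_{i+1} = c_i - 2Δ/μ_i`. [folklore] -/
theorem eulerOffset_succ (i : ℕ) :
    eulerOffset W S N (i + 1) = eulerOffset W S N i - 2 * (eulerStep S N : ℝ) / eulerLevel W S N i :=
  rfl

/-- **The offsets are the Euler images of `0`**: `G^E_i(0) = c_i`, as long as the levels are
positive. [folklore] -/
theorem eulerMap_zero {i : ℕ} (hμ : ∀ j, j < i → 0 < eulerLevel W S N j) :
    eulerMap W S N i 0 = (eulerOffset W S N i : ℂ) := by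
  induction i with
  | zero => simp [eulerMap, eulerOffset]
  | succ i ih =>
    have hμi := hμ i i.lt_succ_self
    have ih' := ih fun j (hj : j < i) ↦ hμ j (hj.trans i.lt_succ_self)
    show map (eulerDriving W S N i) (eulerStep S N) (eulerMap W S N i 0) = _
    rw [ih', eulerOffset_succ]
    have h := (map_linDriving_base (a := W (eulerTime S N i)) hμi (eulerStep S N)).2
    rw [sub_eulerLevel] at h
    exact h

/-- **`G^E_i = c_i + χ_i`**: the Euler map is the restriction map of the Euler hull `B_i`
shifted by the offset, at every point whose steps are all alive (`map_linDriving`). [folklore] -/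
theorem eulerMap_eq {i : ℕ} {z : ℂ} (hμ : ∀ j, j < i → 0 < eulerLevel W S N j)
    (halive : ∀ j, j < i → (eulerStep S N : WithTop ℝ≥0) <
      swallowingTime (eulerDriving W S N j) (eulerMap W S N j z)) :
    eulerMap W S N i z = (eulerOffset W S N i : ℂ) + (eulerStage W S N i).rmap z := by
  induction i with
  | zero => simp [eulerMap, eulerOffset, eulerStage, AStage.empty]
  | succ i ih =>
    have hμi := hμ i i.lt_succ_self
    have ih' := ih (fun j (hj : j < i) ↦ hμ j (hj.trans i.lt_succ_self))
      (fun j (hj : j < i) ↦ halive j (hj.trans i.lt_succ_self))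
    have hst : eulerStage W S N (i + 1) =
        (eulerStage W S N i).mul (eulerLevel W S N i) hμi (eulerStep S N / level (eulerLevel W S N i) ^ 2) := by
      simp [eulerStage, hμi]
    rw [hst, AStage.mul_rmap_apply]
    show map (eulerDriving W S N i) (eulerStep S N) (eulerMap W S N i z) = _
    rw [eulerDriving, map_linDriving hμi (halive i i.lt_succ_self), sub_eulerLevel, ih',
      add_sub_cancel_left, eulerOffset_succ]

/-- **`ℍ ∖ B_i` contains the points of `ℍ` whose steps are all alive.** [folklore] -/
theorem mem_diff_eulerStage {i : ℕ} {z : ℂ} (hz : z ∈ upperHalfPlaneSet)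
    (hμ : ∀ j, j < i → 0 < eulerLevel W S N j)
    (halive : ∀ j, j < i → (eulerStep S N : WithTop ℝ≥0) <
      swallowingTime (eulerDriving W S N j) (eulerMap W S N j z)) :
    z ∈ upperHalfPlaneSet \ (eulerStage W S N i).hull := by
  induction i with
  | zero => simpa [eulerStage, AStage.empty] using hz
  | succ i ih =>
    have hμi := hμ i i.lt_succ_self
    have hμ' := fun j (hj : j < i) ↦ hμ j (hj.trans i.lt_succ_self)
    have halive' := fun j (hj : j < i) ↦ halive j (hj.trans i.lt_succ_self)
    have hst : eulerStage W S N (i + 1) =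
        (eulerStage W S N i).mul (eulerLevel W S N i) hμi (eulerStep S N / level (eulerLevel W S N i) ^ 2) := by
      simp [eulerStage, hμi]
    rw [hst, AStage.mem_diff_mul_iff]
    refine ⟨ih hμ' halive', ?_⟩
    have h := (lt_swallowingTime_linDriving_iff hμi (eulerMap W S N i z) (eulerStep S N)).1
      (halive i i.lt_succ_self)
    rw [sub_eulerLevel, eulerMap_eq hμ' halive', add_sub_cancel_left] at h
    rw [Complex.real_smul, Complex.ofReal_inv, ← div_eq_inv_mul]
    exact h

end Euler

/-! ### The error estimate -/

section Error

variable {W : ℝ≥0 → ℝ} {S : ℝ≥0} {N : ℕ}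

/-- `g_t(0)` is real while `0` flows (a solution started on `ℝ` stays real,
`IsSolution.im_eq_zero_holds`). [folklore] -/
theorem im_map_origin (hW : Continuous W) {t : ℝ≥0}
    (ht : (t : WithTop ℝ≥0) < swallowingTime W 0) : (map W t 0).im = 0 := by
  obtain ⟨g, hg⟩ := exists_isSolution_swallowingTime_holds hW (ne_driving_of_lt_swallowingTime ht)
  rw [map_eq_of_isSolution hW hg ht]
  exact IsSolution.im_eq_zero_holds hg (by simp) t t.coe_nonneg (by simpa using ht)

/-- If `g_t(0)` is within `e` of the real `c` then `c ≥ re g_t(0) - e`. [folklore] -/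
theorem re_sub_le_of_dist_le {c : ℝ} {m : ℂ} {e : ℝ} (h : dist (c : ℂ) m ≤ e) :
    |c - m.re| ≤ e := by
  have := abs_re_le_norm ((c : ℂ) - m)
  rw [Complex.sub_re, Complex.ofReal_re] at this
  rw [dist_eq_norm] at h
  exact this.trans h

/-- **Error estimate of the Euler scheme** (the induction behind "clearly
`Φ^{(n)}_s(z) → Φ_s(z)`", [LSW] p. 13, in the un-normalized frame). Let `W` be continuous, let
`0` flow beyond `S` with `Ũ_t = W_t - g_t(0) ≥ λ₋ > 0` on `[0, S]`, let `0 < δ ≤ λ₋`, and let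
`ω₀` bound the oscillation of `W` over time-lags `≤ Δ = S/(N+1)` in `[0, S]`; put
`ω = ω₀ + 4Δ/λ₋` and `K = 8/δ²` and assume `ω ≤ δ/4`, `ω (e^{KS} - 1) < δ/4`. Then for every `z`
flowing beyond `S` and `δ`-away from `W` on `[0, S]`: all levels `μ_j` (`j ≤ N`) are
`≥ λ₋/2 > 0`, all Euler steps are alive at `z`, and `|G^E_{N+1}(z) - g_S(z)| ≤ ω (e^{KS} - 1)`.
Proof by induction over the steps, for all such `z` simultaneously and `0` among them (whose
Euler images are the offsets `c_i`, `eulerMap_zero`, whence `μ_i ≥ Ũ_{t_i} - e_i ≥ λ₋/2`):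
on `[t_i, t_{i+1}]` the true chain is the chain of `W(t_i + ·)` from `g_{t_i}(z)` (cocycle
`map_add`), the Euler chain is that of `L_i = W(t_i) - 2u/μ_i` from `G^E_i(z)`, the drivers
differ by `≤ ω₀ + 2Δ/μ_i ≤ ω`, and the two-driver tube estimate
(`dist_map_le_of_driving_close`) propagates the error `e_i = ω (e^{K t_i} - 1)` to `e_{i+1}`.
[cite: LawlerSchrammWerner2003Restriction, proof of Lemma 3.5 (p. 13)] -/
theorem dist_eulerMap_map_le (hW : Continuous W) (h0 : (S : WithTop ℝ≥0) < swallowingTime W 0)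
    {lam : ℝ} (hU : ∀ t : ℝ≥0, t ≤ S → lam ≤ W t - (map W t 0).re)
    {δ : ℝ≥0} (hδ : 0 < δ) (hδlam : (δ : ℝ) ≤ lam) {ω₀ : ℝ} (hω₀ : 0 ≤ ω₀)
    (hosc : ∀ s u : ℝ≥0, s + u ≤ S → u ≤ eulerStep S N → |W (s + u) - W s| ≤ ω₀)
    (hω4 : ω₀ + 4 * (eulerStep S N : ℝ) / lam ≤ δ / 4)
    (hωS : (ω₀ + 4 * (eulerStep S N : ℝ) / lam) *
      (Real.exp (2 / ((δ : ℝ) / 2) ^ 2 * S) - 1) < δ / 4)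
    {z : ℂ} (hzS : (S : WithTop ℝ≥0) < swallowingTime W z)
    (hfar : ∀ t : ℝ≥0, t ≤ S → (δ : ℝ) ≤ ‖map W t z - W t‖) :
    (∀ j, j < N + 1 → lam / 2 ≤ eulerLevel W S N j) ∧
      (∀ j, j < N + 1 → (eulerStep S N : WithTop ℝ≥0) <
        swallowingTime (eulerDriving W S N j) (eulerMap W S N j z)) ∧
      dist (eulerMap W S N (N + 1) z) (map W S z) ≤
        (ω₀ + 4 * (eulerStep S N : ℝ) / lam) * (Real.exp (2 / ((δ : ℝ) / 2) ^ 2 * S) - 1) := by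
  have hδ' : (0 : ℝ) < δ := hδ
  have hlam : 0 < lam := hδ'.trans_le hδlam
  set Δ : ℝ≥0 := eulerStep S N with hΔdef
  set ω : ℝ := ω₀ + 4 * (Δ : ℝ) / lam with hωdef
  set K : ℝ := 2 / ((δ : ℝ) / 2) ^ 2 with hKdef
  have hK0 : 0 < K := by rw [hKdef]; positivity
  have hω0 : 0 ≤ ω := by rw [hωdef]; positivity
  -- the error levels `e_i = ω (exp (K t_i) - 1)` and their bound
  set e : ℕ → ℝ := fun i ↦ ω * (Real.exp (K * (eulerTime S N i : ℝ)) - 1) with hedef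
  have he_le : ∀ {i}, i ≤ N + 1 → e i ≤ ω * (Real.exp (K * S) - 1) := fun {i} hi ↦ by
    have h1 : Real.exp (K * (eulerTime S N i : ℝ)) ≤ Real.exp (K * S) :=
      Real.exp_le_exp.2 (mul_le_mul_of_nonneg_left (NNReal.coe_le_coe.2 (eulerTime_le hi)) hK0.le)
    simp only [hedef]
    exact mul_le_mul_of_nonneg_left (by linarith) hω0
  have he_lt : ∀ {i}, i ≤ N + 1 → e i < δ / 4 := fun hi ↦ (he_le hi).trans_lt hωS
  -- the good set, containing `z` and `0`
  set Good : Set ℂ := {y | (S : WithTop ℝ≥0) < swallowingTime W y ∧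
    ∀ t : ℝ≥0, t ≤ S → (δ : ℝ) ≤ ‖map W t y - W t‖} with hGood
  have hzG : z ∈ Good := ⟨hzS, hfar⟩
  have h0G : (0 : ℂ) ∈ Good := by
    refine ⟨h0, fun t ht ↦ ?_⟩
    have h1 := abs_re_le_norm (map W t 0 - W t)
    rw [Complex.sub_re, Complex.ofReal_re] at h1
    have h2 := hU t ht
    have h3 : |(map W t 0).re - W t| = W t - (map W t 0).re := by
      rw [abs_sub_comm, abs_of_nonneg (by linarith)]
    linarith
  -- the induction
  have main : ∀ i, i ≤ N + 1 →
      (∀ j, j < i → lam / 2 ≤ eulerLevel W S N j) ∧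
        eulerMap W S N i 0 = (eulerOffset W S N i : ℂ) ∧
        ∀ y ∈ Good, (∀ j, j < i → (Δ : WithTop ℝ≥0) <
            swallowingTime (eulerDriving W S N j) (eulerMap W S N j y)) ∧
          dist (eulerMap W S N i y) (map W (eulerTime S N i) y) ≤ e i := by
    intro i
    induction i with
    | zero =>
      intro _
      refine ⟨fun j hj ↦ absurd hj (Nat.not_lt_zero j), by simp [eulerMap, eulerOffset], fun y hy ↦
        ⟨fun j hj ↦ absurd hj (Nat.not_lt_zero j), ?_⟩⟩
      have hy0 : y ≠ W 0 := ne_driving_of_lt_swallowingTime hy.1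
      simp [eulerMap, map_zero_apply hW hy0, hedef]
    | succ i ih =>
      intro hi1
      obtain ⟨hL, hZ, hY⟩ := ih (Nat.le_of_succ_le hi1)
      have hti : eulerTime S N i + Δ ≤ S := by rw [← eulerTime_succ]; exact eulerTime_le hi1
      have htiS : eulerTime S N i ≤ S := le_self_add.trans hti
      -- the level `μ_i ≥ λ₋/2`
      have hμi : lam / 2 ≤ eulerLevel W S N i := by
        have h1 := (hY 0 h0G).2
        rw [hZ] at h1
        have h2 := re_sub_le_of_dist_le h1
        have h3 := hU _ htiS
        have h4 : e i < δ / 4 := he_lt (Nat.le_of_succ_le hi1)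
        have h5 := (abs_le.1 h2).2
        simp only [eulerLevel]
        linarith
      have hμi0 : 0 < eulerLevel W S N i := by linarith
      have hL' : ∀ j, j < i + 1 → lam / 2 ≤ eulerLevel W S N j := fun j hj ↦ by
        rcases Nat.lt_succ_iff_lt_or_eq.1 hj with hj | rfl
        · exact hL j hj
        · exact hμi
      refine ⟨hL', eulerMap_zero fun j hj ↦ by linarith [hL' j hj], fun y hy ↦ ?_⟩
      -- the step for a good point `y`
      obtain ⟨halive, hdist⟩ := hY y hy
      set w : ℂ := map W (eulerTime S N i) y with hwdef
      have htr : ((eulerTime S N i + Δ : ℝ≥0) : WithTop ℝ≥0) < swallowingTime W y :=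
        lt_of_le_of_lt (WithTop.coe_le_coe.2 hti) hy.1
      have hcoc := map_add hW htr
      -- the shifted driving function and its distance to the frozen one
      set Wi : ℝ≥0 → ℝ := fun u ↦ W (eulerTime S N i + u) with hWi
      have hWic : Continuous Wi := continuous_shift W hW _
      have hfari : ∀ s : ℝ≥0, s ≤ Δ → (δ : ℝ) ≤ ‖map Wi s w - Wi s‖ := by
        intro s hs
        have hts : eulerTime S N i + s ≤ S :=
          le_trans (by gcongr : eulerTime S N i + s ≤ eulerTime S N i + Δ) hti
        have htrs : ((eulerTime S N i + s : ℝ≥0) : WithTop ℝ≥0) < swallowingTime W y :=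
          lt_of_le_of_lt (WithTop.coe_le_coe.2 hts) hy.1
        have h1 := (map_add hW htrs).2
        rw [hwdef, ← h1]
        exact hy.2 _ hts
      have hWW' : ∀ s : ℝ≥0, s ≤ Δ → |Wi s - eulerDriving W S N i s| ≤ ω := by
        intro s hs
        have hts : eulerTime S N i + s ≤ S :=
          le_trans (by gcongr : eulerTime S N i + s ≤ eulerTime S N i + Δ) hti
        have h1 := hosc (eulerTime S N i) s hts hs
        have h2 := abs_linDriving_sub_le (a := W (eulerTime S N i)) hμi0 hs
        have h3 : 2 * (Δ : ℝ) / eulerLevel W S N i ≤ 4 * (Δ : ℝ) / lam := by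
          rw [div_le_div_iff₀ hμi0 hlam]
          have : (0 : ℝ) ≤ Δ := Δ.coe_nonneg
          nlinarith
        calc |Wi s - eulerDriving W S N i s|
            = |(W (eulerTime S N i + s) - W (eulerTime S N i)) -
                (eulerDriving W S N i s - W (eulerTime S N i))| := by simp only [hWi]; ring_nf
          _ ≤ |W (eulerTime S N i + s) - W (eulerTime S N i)| +
                |eulerDriving W S N i s - W (eulerTime S N i)| := abs_sub _ _
          _ ≤ ω₀ + 2 * (Δ : ℝ) / eulerLevel W S N i := add_le_add h1 h2
          _ ≤ ω := by rw [hωdef]; linarith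
      have hωδ : ω ≤ δ / 4 := hω4
      -- smallness: `e_i e^{KΔ} + ω (e^{KΔ} - 1) = e_{i+1} < δ/4`
      have hexp : Real.exp (K * (eulerTime S N i : ℝ)) * Real.exp (K * Δ) =
          Real.exp (K * (eulerTime S N (i + 1) : ℝ)) := by
        rw [← Real.exp_add, eulerTime_succ, NNReal.coe_add, mul_add]
      have hstep : e i * Real.exp (K * Δ) + ω * (Real.exp (K * Δ) - 1) = e (i + 1) := by
        simp only [hedef]
        rw [← hexp]; ring
      have hsmall : dist (eulerMap W S N i y) w * Real.exp (2 / ((δ : ℝ) / 2) ^ 2 * Δ) +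
          ω * (Real.exp (2 / ((δ : ℝ) / 2) ^ 2 * Δ) - 1) < δ / 4 := by
        rw [← hKdef]
        have h1 : dist (eulerMap W S N i y) w * Real.exp (K * Δ) ≤ e i * Real.exp (K * Δ) :=
          mul_le_mul_of_nonneg_right hdist (Real.exp_pos _).le
        have h2 := he_lt hi1
        linarith
      obtain ⟨hal, hd⟩ := dist_map_le_of_driving_close (z' := eulerMap W S N i y) hWic
        (continuous_linDriving _ _) hcoc.1 hδ hfari hω0 hωδ hWW' hsmall
      refine ⟨fun j hj ↦ ?_, ?_⟩
      · rcases Nat.lt_succ_iff_lt_or_eq.1 hj with hj | rfl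
        · exact halive j hj
        · exact hal
      · have h1 : dist (eulerMap W S N (i + 1) y) (map Wi Δ w) ≤
            dist (eulerMap W S N i y) w * Real.exp (K * Δ) + ω * (Real.exp (K * Δ) - 1) := by
          have := hd Δ le_rfl
          rw [← hKdef, ← hwdef] at this
          exact this
        have h2 : dist (eulerMap W S N i y) w * Real.exp (K * Δ) ≤ e i * Real.exp (K * Δ) :=
          mul_le_mul_of_nonneg_right hdist (Real.exp_pos _).le
        have h3 : map W (eulerTime S N (i + 1)) y = map Wi Δ w := by
          rw [eulerTime_succ, hwdef]; exact hcoc.2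
        rw [h3]
        linarith
  obtain ⟨hL, -, hY⟩ := main (N + 1) le_rfl
  obtain ⟨halive, hdist⟩ := hY z hzG
  have hlast : e (N + 1) = ω * (Real.exp (K * S) - 1) := by simp only [hedef, eulerTime_last]
  rw [eulerTime_last, hlast] at hdist
  exact ⟨hL, halive, hdist⟩

end Error

end Loewner

end Literature.Probability.RandomPlanarGeometry

end
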